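import Summits.HodgeConjecture.HodgeConjecture.Theorems.SignSymmetricPowersGenPairBranches
import Summits.HodgeConjecture.HodgeConjecture.Theorems.SignSymmetricPowersGenPairOrder
import Literature.AlgebraicGeometry.Dimension.HypersurfaceIdentityPrinciple
import Literature.NumberTheory.Transcendental.AnalytificationImplicit
import Mathlib.Analysis.Calculus.Deriv.Slope
import Mathlib.Analysis.Calculus.Deriv.Mul
import HarnessLib

/-!
# K1-B meridian package, G2 part (d): THE PAIR CENTRE — the prime factor of `D_M` through a form with an exchanged
# pair of nodes is unique, has multiplicity two, and is transversal to the pencils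
# (route `SignSymmetricPowers`, item stmt-HodgeConjecture-19716; helper for GEN / LINK-G)

Helper file (`--supports stmt-HodgeConjecture-19716`).  This is item ✗3 of prover-B's INDEX ("PAIR centres … need G2")
and the `Meridian` fields `eval_center`, `eval_center_ne`, `transversal` at the pair-type witness of GEN
(`stub_signMeridianGeneration`) / the pair pencils of LINK-G (`stub_signConfluenceLinkG`).

`exists_unique_factor_pair`: let `γ` fix the monomials of `M`, `D_M = killHom Disc = w · ∏ⱼ hⱼ^{eⱼ}` (`w` a unit,
`hⱼ` pairwise non-associated irreducibles, `eⱼ ≥ 1`), F-DISC-1 GRANTED, `f` an `M`-supported form whose singular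
points are exactly two nodes `q`, `q' = γ•q` (`γ•q' = q`), `m₀ ∈ M` a monomial with `q^{m₀} ≠ 0`, `g_sep` a degree-`d`
form separating `q` from `q'`, and `g` an `M`-supported pencil direction with `g(q), g(q') ≠ 0`.  Then EXACTLY ONE
factor `h_{j₀}` vanishes at `a = coeff_M f`, its multiplicity is `e_{j₀} = 2`, and `Σ_k ∂_k h_{j₀}(a) · coeff_M(g)_k ≠ 0`.

Proof.  (1) `SignSymmetricPowersGenPairBranches.pair_localFactorization`: near `a`, `D_M = u ℓ₀ ℓ₁` with the smooth
branches `ℓ₀, ℓ₁` having the SAME zero set `Z`; hence `Z = {D_M = 0}` near `a` and all partials `∂_k D_M` vanish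
on `Z` (product rule).  (2) Implicit-function chart of `Z` along the coordinate `m₀`
(`Literature.Analysis.Complex.exists_implicitChart_of_analyticAt`); `Z` is covered by the closed sets `{hⱼ = 0}`,
`j ∈ J = {j | hⱼ(a) = 0}`, so one `h_{j₀}` contains an open piece of the graph
(`exists_open_subset_of_subset_iUnion_closed`); the identity principle
(`Literature.AlgebraicGeometry.Dimension.dvd_of_forall_exists_common_root_update`) gives `h_{j₀} ∣ ∂_k D_M` for all
`k`, whence `e_{j₀} ≥ 2` (`two_le_of_dvd_pderiv`).  (3) Along the pencil `c ↦ a + c·coeff_M g`: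
`D_M(a + cv)/c² → u(a)·c₀g(q)·c₁g(q') ≠ 0`, so `X³ ∤ D_M|_{line}`; since `X^{Σ_{j ∈ J} eⱼ}` divides it, `J = {j₀}`,
`e_{j₀} = 2`, and `h_{j₀}|_{line}` has a simple zero (else `X⁴ ∣ D_M|_{line}`): transversality.

Sorry-free; axioms standard; no definition, no named fact (F-DISC-1 is a hypothesis).

## References

* [VoisinHodgeII2003] C. Voisin, Hodge Theory and Complex Algebraic Geometry II (CUP 2003), §2.1.1 Lemma 2.7,
  Cor. 2.8, pp. 69–70; §2.3.1.
* [Shimada2010ZvK] I. Shimada, Lectures on Zariski–van Kampen theorem, §3 (meridians).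
-/

noncomputable section

set_option linter.dupNamespace false

open MvPolynomial
open _root_.Topology _root_.Filter
open Literature.AlgebraicGeometry.Motives Literature.AlgebraicGeometry.Motives.UniversalHypersurface
open Literature.AlgebraicGeometry.HodgeTheory
open Summit.HodgeConjecture.HodgeConjecture.Theorems.SignSymmetricPowersGenDiagonalCoeff
open Summit.HodgeConjecture.HodgeConjecture.Theorems.SignSymmetricPowersMeridianOneNode
open Summit.HodgeConjecture.HodgeConjecture.Theorems.SignSymmetricPowersMeridianChart
open Summit.HodgeConjecture.HodgeConjecture.Theorems.SignSymmetricPowersGenPairBranches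
open Summit.HodgeConjecture.HodgeConjecture.Theorems.SignSymmetricPowersGenPairOrder

namespace Summit.HodgeConjecture.HodgeConjecture.Theorems.SignSymmetricPowersGenPairCentre

variable (n d : ℕ) (M : Set (DegIndex n d)) [DecidablePred (· ∈ M)]

/-! ### §1 Small plumbing -/

omit [DecidablePred (· ∈ M)] in
/-- Two points of `ℂ^M` with the same coordinates off `m₀` differ by an update at `m₀`. [folklore] -/
theorem eq_update_of_drop_eq (m₀ : M) {z b : M → ℂ}
    (h : (fun t : {j : M // j ≠ m₀} => z t.1) = fun t => b t.1) : z = Function.update b m₀ (z m₀) := by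
  funext j
  by_cases hj : j = m₀
  · subst hj; simp
  · have := congr_fun h ⟨j, hj⟩
    simpa [Function.update_of_ne hj] using this

/-- The form of the extension by zero of the basis vector `e_{m₀}` of `ℂ^M` is the monomial `x^{m₀}`.
[cite: VoisinHodgeII2003, §6.2.1] -/
theorem formOfCoeffs_extend_single (m₀ : M) :
    formOfCoeffs (fun m : DegIndex n d => if h : m ∈ M then (Pi.single m₀ (1 : ℂ) : M → ℂ) ⟨m, h⟩ else 0) =
      monomial m₀.1.1 1 := by
  classical
  have hfun : (fun m : DegIndex n d => if h : m ∈ M then (Pi.single m₀ (1 : ℂ) : M → ℂ) ⟨m, h⟩ else 0) =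
      Pi.single (m₀.1 : DegIndex n d) (1 : ℂ) := by
    funext m
    by_cases hm : m ∈ M
    · rw [dif_pos hm]
      by_cases hmm : (⟨m, hm⟩ : M) = m₀
      · have : m = m₀.1 := congrArg Subtype.val hmm
        subst this
        simp [hmm]
      · have : m ≠ m₀.1 := fun h => hmm (Subtype.ext h)
        simp [hmm, this]
    · have : m ≠ m₀.1 := fun h => hm (h ▸ m₀.2)
      rw [dif_neg hm, Pi.single_apply, if_neg this]
  rw [hfun, formOfCoeffs_def, Finset.sum_eq_single (m₀.1 : DegIndex n d)]
  · simp
  · intro m _ hm; rw [Pi.single_apply, if_neg hm, monomial_zero]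
  · intro h; exact absurd (Finset.mem_univ _) h

/-- Evaluation of a polynomial at a point where a unit polynomial takes a non-zero value. [folklore] -/
theorem eval_ne_zero_of_isUnit {σ : Type*} {w : MvPolynomial σ ℂ} (hw : IsUnit w) (b : σ → ℂ) :
    MvPolynomial.eval b w ≠ 0 :=
  (hw.map (MvPolynomial.eval b)).ne_zero

/-! ### §2 The pair centre -/

/-- **The prime factor of the restricted discriminant through a form with an exchanged pair of nodes is unique,
of multiplicity two, and transversal to the pencils** (see the module docstring for the statement and proof).
[cite: VoisinHodgeII2003, §2.1.1 Lemma 2.7, Cor. 2.8 and pp. 69–70] [cite: Shimada2010ZvK, §3 Definition before Prop. 3.4] -/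
theorem exists_unique_factor_pair (hB : discriminant_localBranches_nodal) {Disc : MvPolynomial (DegIndex n d) ℂ}
    (hirr : Irreducible Disc) (hV : ∀ a : DegIndex n d → ℂ, a ∈ singularCoeffs n d ↔ MvPolynomial.eval a Disc = 0)
    {γ : Fin (n + 2) → ℂˣ} (hγ : FixesMonomials ℂ n d M γ)
    {m : ℕ} (w : MvPolynomial M ℂ) (hw : IsUnit w) (h : Fin m → MvPolynomial M ℂ) (e : Fin m → ℕ)
    (hirrh : ∀ j, Irreducible (h j)) (hna : ∀ i j, i ≠ j → ¬ Associated (h i) (h j)) (he : ∀ j, 1 ≤ e j)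
    (hfac : killHom ℂ n d M Disc = w * ∏ j, h j ^ e j)
    {f : MvPolynomial (Fin (n + 2)) ℂ} (hf : f.IsHomogeneous d) (hMf : IsSupportedOn n d M f)
    {q q' : Fin (n + 2) → ℂ} (hq' : (fun i => (γ i : ℂ) * q i) = q') (hq : (fun i => (γ i : ℂ) * q' i) = q)
    (hnod : IsNodalFormWithNodes f ![q, q'])
    {gsep : MvPolynomial (Fin (n + 2)) ℂ} (hgsep : gsep.IsHomogeneous d) (hgsq : MvPolynomial.eval q gsep ≠ 0)
    (hgsq' : MvPolynomial.eval q' gsep = 0)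
    (m₀ : M) (hm₀ : MvPolynomial.eval q (monomial m₀.1.1 (1 : ℂ)) ≠ 0)
    {g : MvPolynomial (Fin (n + 2)) ℂ} (hg : g.IsHomogeneous d) (hMg : IsSupportedOn n d M g)
    (hgq : MvPolynomial.eval q g ≠ 0) (hgq2 : MvPolynomial.eval q' g ≠ 0) :
    haveI : Fintype M := Subtype.fintype _
    ∃ j₀, MvPolynomial.eval (fun m' : M => coeff m'.1.1 f) (h j₀) = 0 ∧ e j₀ = 2 ∧
      (∀ i, i ≠ j₀ → MvPolynomial.eval (fun m' : M => coeff m'.1.1 f) (h i) ≠ 0) ∧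
      ∑ k, MvPolynomial.eval (fun m' : M => coeff m'.1.1 f) (pderiv k (h j₀)) * (fun m' : M => coeff m'.1.1 g) k ≠ 0 := by
  classical
  -- notation
  set a : M → ℂ := fun m' : M => coeff m'.1.1 f with ha_def
  set v : M → ℂ := fun m' : M => coeff m'.1.1 g with hv_def
  let ext : (M → ℂ) → (DegIndex n d → ℂ) := fun b m => if h : m ∈ M then b ⟨m, h⟩ else 0
  have hext_def : ∀ b, ext b = fun m => if h : m ∈ M then b ⟨m, h⟩ else 0 := fun b => rfl
  let extL : (M → ℂ) →L[ℂ] (DegIndex n d → ℂ) := ContinuousLinearMap.pi fun m : DegIndex n d =>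
    if h : m ∈ M then ContinuousLinearMap.proj (R := ℂ) (φ := fun _ : M => ℂ) ⟨m, h⟩ else 0
  have hextL : ∀ b, extL b = ext b := fun b => extCLM_apply n d M b
  have ha_ext : ext a = coeffsOf n d f := extend_coeffM_eq_coeffsOf n d M hMf
  have hv_ext : ext v = coeffsOf n d g := extend_coeffM_eq_coeffsOf n d M hMg
  -- (1) local factorization with coinciding branches
  obtain ⟨O, φ₀, φ₁, u, c₀, c₁, hO, haO, hc0, hc1, hℓ0an, hℓ1an, huan, hφ0a, hφ1a, hdℓ0, hdℓ1, hu0, hfacO, hiff⟩ :=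
    pair_localFactorization n d M hB hirr hV hγ hf hMf hq' hq hnod hgsep hgsq hgsq'
  set D : MvPolynomial M ℂ := killHom ℂ n d M Disc with hD_def
  have hℓ0a : φ₀ (ext a) = 0 := by rw [ha_ext]; exact hφ0a
  have hℓ1a : φ₁ (ext a) = 0 := by rw [ha_ext]; exact hφ1a
  have hℓ0a' : φ₀ (fun m => if h : m ∈ M then a ⟨m, h⟩ else 0) = 0 := hℓ0a
  have hℓ1a' : φ₁ (fun m => if h : m ∈ M then a ⟨m, h⟩ else 0) = 0 := hℓ1a
  -- Z = {D = 0} = {ℓ₀ = 0} near `a`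
  have hZ1 : ∀ b ∈ O, MvPolynomial.eval b D = 0 ↔ φ₀ (ext b) = 0 := by
    intro b hb
    rw [hfacO b hb]
    constructor
    · intro h0
      rcases mul_eq_zero.mp h0 with h1 | h1
      · rcases mul_eq_zero.mp h1 with h2 | h2
        · exact absurd h2 (hu0 b hb)
        · exact h2
      · exact (hiff b hb).mpr h1
    · intro h0; rw [h0, mul_zero, zero_mul]
  -- all partials of `D` vanish on `Z`
  have hZ2 : ∀ b ∈ O, φ₀ (ext b) = 0 → ∀ k, MvPolynomial.eval b (pderiv k D) = 0 := by
    intro b hb h0 k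
    have h1 : φ₁ (ext b) = 0 := (hiff b hb).mp h0
    -- `D` as a function agrees near `b` with `(u ℓ₀) · ℓ₁`, a product of two functions vanishing at `b`
    have hℓ0d := (hℓ0an b hb).differentiableAt.hasFDerivAt
    have hℓ1d := (hℓ1an b hb).differentiableAt.hasFDerivAt
    have hud := (huan b hb).differentiableAt.hasFDerivAt
    have hprod := ((hud.mul hℓ0d).mul hℓ1d).congr_fderiv (g' := 0) (by
      have h0' : φ₀ (fun m => if h : m ∈ M then b ⟨m, h⟩ else 0) = 0 := h0
      have h1' : φ₁ (fun m => if h : m ∈ M then b ⟨m, h⟩ else 0) = 0 := h1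
      ext x; simp [h0', h1'])
    have hD' : HasFDerivAt (fun b' : M → ℂ => MvPolynomial.eval b' D) (0 : (M → ℂ) →L[ℂ] ℂ) b := by
      refine hprod.congr_of_eventuallyEq ?_
      filter_upwards [hO.mem_nhds hb] with b' hb'
      exact hfacO b' hb'
    have hpoly := Literature.NumberTheory.Transcendental.hasFDerivAt_eval D b
    have huniq := hpoly.unique hD'
    have := DFunLike.congr_fun huniq (Pi.single k 1)
    simpa [Finset.sum_apply, Pi.single_apply] using this
  -- (2) the factors through `a`; shrink `O`
  set J : Finset (Fin m) := Finset.univ.filter fun j => MvPolynomial.eval a (h j) = 0 with hJ_def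
  set O₁ : Set (M → ℂ) := O ∩ ⋂ j ∈ (Finset.univ.filter fun j => MvPolynomial.eval a (h j) ≠ 0),
    {b | MvPolynomial.eval b (h j) ≠ 0} with hO₁_def
  have hO₁ : IsOpen O₁ := by
    refine hO.inter (isOpen_biInter_finset fun j _ => ?_)
    exact isOpen_ne_fun (MvPolynomial.continuous_eval (h j)) continuous_const
  have haO₁ : a ∈ O₁ := by
    refine ⟨haO, Set.mem_iInter₂.mpr fun j hj => ?_⟩
    exact (Finset.mem_filter.mp hj).2
  have hO₁O : O₁ ⊆ O := fun b hb => hb.1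
  have hO₁ne : ∀ b ∈ O₁, ∀ j, MvPolynomial.eval b (h j) = 0 → j ∈ J := by
    intro b hb j hj
    by_contra hjJ
    have hja : MvPolynomial.eval a (h j) ≠ 0 := by
      intro h0; exact hjJ (Finset.mem_filter.mpr ⟨Finset.mem_univ _, h0⟩)
    have := Set.mem_iInter₂.mp hb.2 j (Finset.mem_filter.mpr ⟨Finset.mem_univ _, hja⟩)
    exact this hj
  -- on `Z ∩ O₁` some `h j`, `j ∈ J`, vanishes
  have hcoverZ : ∀ b ∈ O₁, φ₀ (ext b) = 0 → ∃ j ∈ J, MvPolynomial.eval b (h j) = 0 := by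
    intro b hb h0
    have hD0 : MvPolynomial.eval b D = 0 := (hZ1 b (hO₁O hb)).mpr h0
    rw [hfac, map_mul, map_prod] at hD0
    rcases mul_eq_zero.mp hD0 with h1 | h1
    · exact absurd h1 (eval_ne_zero_of_isUnit hw b)
    · obtain ⟨j, -, hj⟩ := Finset.prod_eq_zero_iff.mp h1
      rw [map_pow] at hj
      have hej : e j ≠ 0 := by have := he j; omega
      have hj' : MvPolynomial.eval b (h j) = 0 := (pow_eq_zero_iff hej).mp hj
      exact ⟨j, hO₁ne b hb j hj', hj'⟩
  -- (3) the implicit-function chart of `Z` along the coordinate `m₀`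
  set ℓ : (M → ℂ) → ℂ := fun b => φ₀ (ext b) with hℓ_def
  have hℓan : AnalyticAt ℂ ℓ a := hℓ0an a haO
  have hℓder : fderiv ℂ ℓ a = (c₀ • evalCoeffCLM n d q).comp extL := hdℓ0.fderiv
  have hk : fderiv ℂ ℓ a (Pi.single m₀ 1) ≠ 0 := by
    rw [hℓder, ContinuousLinearMap.comp_apply, hextL, _root_.smul_apply, evalCoeffCLM_apply,
      hext_def, formOfCoeffs_extend_single]
    exact smul_ne_zero hc0 hm₀
  obtain ⟨Ω, T, ψ, hΩ, haΩ, hT, hψ, hzero, hgraph⟩ :=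
    Literature.Analysis.Complex.exists_implicitChart_of_analyticAt (ι := M) m₀ hℓan hk
  have hψc : ContinuousOn ψ T := hψ.continuousOn
  -- (4) the closed cover of the chart domain
  set T₁ : Set ({j : M // j ≠ m₀} → ℂ) := T ∩ ψ ⁻¹' O₁ with hT₁_def
  have hT₁ : IsOpen T₁ := hψc.isOpen_inter_preimage hT hO₁
  have haT : (fun t : {j : M // j ≠ m₀} => a t.1) ∈ T := (hzero a haΩ hℓ0a).1
  have hψa : ψ (fun t : {j : M // j ≠ m₀} => a t.1) = a := (hzero a haΩ hℓ0a).2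
  have hT₁ne : T₁.Nonempty := ⟨_, haT, by change ψ _ ∈ O₁; rw [hψa]; exact haO₁⟩
  -- closed sets `F j = (T₁ ∩ ψ⁻¹ {h j ≠ 0})ᶜ`
  set F : Fin m → Set ({j : M // j ≠ m₀} → ℂ) := fun j =>
    (T₁ ∩ ψ ⁻¹' {b | MvPolynomial.eval b (h j) ≠ 0})ᶜ with hF_def
  have hFclosed : ∀ j ∈ J, IsClosed (F j) := fun j _ =>
    ((hψc.mono Set.inter_subset_left).isOpen_inter_preimage hT₁
      (isOpen_ne_fun (MvPolynomial.continuous_eval (h j)) continuous_const)).isClosed_compl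
  have hcoverT : T₁ ⊆ ⋃ j ∈ J, F j := by
    intro w' hw'
    have hℓw : φ₀ (ext (ψ w')) = 0 := (hgraph w' hw'.1).2.1
    obtain ⟨j, hjJ, hj⟩ := hcoverZ (ψ w') hw'.2 hℓw
    refine Set.mem_iUnion₂.mpr ⟨j, hjJ, ?_⟩
    intro hmem
    exact hmem.2 hj
  obtain ⟨j₀, hj₀J, B', hB'o, hB'ne, hB'T₁, hB'F⟩ :=
    exists_open_subset_of_subset_iUnion_closed J F hFclosed hT₁ hT₁ne hcoverT
  have hj₀a : MvPolynomial.eval a (h j₀) = 0 := (Finset.mem_filter.mp hj₀J).2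
  have hB'zero : ∀ w' ∈ B', MvPolynomial.eval (ψ w') (h j₀) = 0 := by
    intro w' hw'
    by_contra hne
    exact hB'F hw' ⟨hB'T₁ hw', hne⟩
  -- (5) the identity principle: `h j₀ ∣ ∂_k D`
  let π : (M → ℂ) → ({j : M // j ≠ m₀} → ℂ) := fun b t => b t.1
  have hπc : Continuous π := continuous_pi fun t => continuous_apply t.1
  have hdvd : ∀ k, h j₀ ∣ pderiv k D := by
    intro k
    refine Literature.AlgebraicGeometry.Dimension.dvd_of_forall_exists_common_root_update (σ := M) m₀ (hirrh j₀)
      (U := Ω ∩ π ⁻¹' B') (hΩ.inter (hB'o.preimage hπc)) ?_ ?_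
    · obtain ⟨w', hw'⟩ := hB'ne
      refine ⟨ψ w', (hgraph w' (hB'T₁ hw').1).1, ?_⟩
      change π (ψ w') ∈ B'
      have : π (ψ w') = w' := (hgraph w' (hB'T₁ hw').1).2.2
      rw [this]; exact hw'
    · intro b hb
      have hw' : π b ∈ B' := hb.2
      have hw'T : π b ∈ T := (hB'T₁ hw').1
      set z := ψ (π b) with hz_def
      have hπz : π z = π b := (hgraph (π b) hw'T).2.2
      have hzb : z = Function.update b m₀ (z m₀) := eq_update_of_drop_eq n d M m₀ hπz
      refine ⟨z m₀, ?_, ?_⟩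
      · rw [← hzb]; exact hB'zero _ hw'
      · rw [← hzb]
        exact hZ2 z (hO₁O (hB'T₁ hw').2) (hgraph (π b) hw'T).2.1 k
  -- (6) multiplicity at least two
  have hsplit : D = h j₀ ^ e j₀ * (w * ∏ j ∈ Finset.univ.erase j₀, h j ^ e j) := by
    rw [hfac, ← Finset.mul_prod_erase Finset.univ (fun j => h j ^ e j) (Finset.mem_univ j₀)]
    ring
  have hR : ¬ h j₀ ∣ w * ∏ j ∈ Finset.univ.erase j₀, h j ^ e j := not_dvd_unit_mul_prod_erase hw hirrh hna e j₀
  have he2 : 2 ≤ e j₀ :=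
    two_le_of_dvd_pderiv (hirrh j₀) hR (he j₀) (fun k => by rw [← hsplit]; exact hdvd k)
  -- (7) the order along the pencil `c ↦ a + c v`
  set line : M → Polynomial ℂ := fun k => Polynomial.C (a k) + Polynomial.C (v k) * Polynomial.X with hline
  set P : Polynomial ℂ := aeval line D with hP_def
  have hPeval : ∀ c : ℂ, P.eval c = MvPolynomial.eval (a + c • v) D := fun c => eval_aeval_line a v D c
  -- (7a) the limit `P(c)/c² → u(a)·κ₀·κ₁ ≠ 0`
  have hlineD : HasDerivAt (fun c : ℂ => a + c • v) v 0 := by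
    simpa using ((hasDerivAt_id (0 : ℂ)).smul_const v).const_add a
  have hκ0 : HasDerivAt (fun c : ℂ => φ₀ (ext (a + c • v))) (c₀ * MvPolynomial.eval q g) 0 := by
    have h1 : HasFDerivAt (fun b : M → ℂ => φ₀ (ext b)) ((c₀ • evalCoeffCLM n d q).comp extL) (a + (0 : ℂ) • v) := by
      rw [zero_smul, add_zero]; exact hdℓ0
    have h2 := h1.comp_hasDerivAt (0 : ℂ) hlineD
    have hval : ((c₀ • evalCoeffCLM n d q).comp extL) v = c₀ * MvPolynomial.eval q g := by
      rw [ContinuousLinearMap.comp_apply, hextL, _root_.smul_apply, hv_ext, evalCoeffCLM_coeffsOf hg,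
        smul_eq_mul]
    rwa [hval] at h2
  have hκ1 : HasDerivAt (fun c : ℂ => φ₁ (ext (a + c • v))) (c₁ * MvPolynomial.eval q' g) 0 := by
    have h1 : HasFDerivAt (fun b : M → ℂ => φ₁ (ext b)) ((c₁ • evalCoeffCLM n d q').comp extL) (a + (0 : ℂ) • v) := by
      rw [zero_smul, add_zero]; exact hdℓ1
    have h2 := h1.comp_hasDerivAt (0 : ℂ) hlineD
    have hval : ((c₁ • evalCoeffCLM n d q').comp extL) v = c₁ * MvPolynomial.eval q' g := by
      rw [ContinuousLinearMap.comp_apply, hextL, _root_.smul_apply, hv_ext, evalCoeffCLM_coeffsOf hg,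
        smul_eq_mul]
    rwa [hval] at h2
  have hslope0 : Tendsto (fun c : ℂ => c⁻¹ * φ₀ (ext (a + c • v))) (𝓝[≠] 0) (𝓝 (c₀ * MvPolynomial.eval q g)) := by
    have := hκ0.tendsto_slope_zero
    simpa [hℓ0a, hℓ0a'] using this
  have hslope1 : Tendsto (fun c : ℂ => c⁻¹ * φ₁ (ext (a + c • v))) (𝓝[≠] 0) (𝓝 (c₁ * MvPolynomial.eval q' g)) := by
    have := hκ1.tendsto_slope_zero
    simpa [hℓ1a, hℓ1a'] using this
  have hucont : Tendsto (fun c : ℂ => u (ext (a + c • v))) (𝓝[≠] 0) (𝓝 (u (ext a))) := by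
    have h1 : ContinuousAt (fun b : M → ℂ => u (ext b)) a := (huan a haO).continuousAt
    have h2 : Tendsto (fun c : ℂ => a + c • v) (𝓝 0) (𝓝 a) := by
      have := hlineD.continuousAt.tendsto; simpa using this
    exact (h1.tendsto.comp h2).mono_left nhdsWithin_le_nhds
  set L : ℂ := u (ext a) * ((c₀ * MvPolynomial.eval q g) * (c₁ * MvPolynomial.eval q' g)) with hL_def
  have hL : L ≠ 0 := mul_ne_zero (hu0 a haO) (mul_ne_zero (mul_ne_zero hc0 hgq) (mul_ne_zero hc1 hgq2))
  have hmemO : ∀ᶠ c : ℂ in 𝓝[≠] 0, a + c • v ∈ O := by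
    have h2 : Tendsto (fun c : ℂ => a + c • v) (𝓝 0) (𝓝 a) := by
      have := hlineD.continuousAt.tendsto; simpa using this
    exact (h2.eventually (hO.mem_nhds haO)).filter_mono nhdsWithin_le_nhds
  have hlim : Tendsto (fun c : ℂ => P.eval c / c ^ 2) (𝓝[≠] 0) (𝓝 L) := by
    have hprod := hucont.mul (hslope0.mul hslope1)
    refine hprod.congr' ?_
    filter_upwards [hmemO, self_mem_nhdsWithin] with c hc hc0'
    rw [hPeval, hfacO _ hc]
    generalize u (ext (a + c • v)) = U₀
    generalize φ₀ (ext (a + c • v)) = V₀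
    generalize φ₁ (ext (a + c • v)) = V₁
    have hc0'' : (c : ℂ) ≠ 0 := hc0'
    field_simp
  -- (7b) the algebraic side
  have hnot3 : ¬ Polynomial.X ^ 3 ∣ P := not_X_pow_three_dvd_of_tendsto_div_sq hL hlim
  set Q : Fin m → Polynomial ℂ := fun j => aeval line (h j) with hQ_def
  have hQeval : ∀ j, (Q j).eval 0 = MvPolynomial.eval a (h j) := by
    intro j
    have := eval_aeval_line a v (h j) 0
    rw [zero_smul, add_zero] at this
    exact this
  have hPfac : P = aeval line w * ∏ j, Q j ^ e j := by
    simp only [hP_def, hQ_def, hfac, map_mul, map_prod, map_pow]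
  have hXe : Polynomial.X ^ e j₀ ∣ ∏ j, Q j ^ e j :=
    (X_pow_dvd_pow_of_eval_zero (by rw [hQeval]; exact hj₀a) (e j₀)).trans
      (Finset.dvd_prod_of_mem (fun j => Q j ^ e j) (Finset.mem_univ j₀))
  -- `e j₀ = 2`
  have he_eq : e j₀ = 2 := by
    by_contra hne
    have h3 : 3 ≤ e j₀ := by omega
    exact hnot3 ((pow_dvd_pow Polynomial.X h3).trans (hXe.trans (Dvd.intro_left _ hPfac.symm)))
  refine ⟨j₀, hj₀a, he_eq, ?_, ?_⟩
  · -- uniqueness of the vanishing factor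
    intro i hi hia
    have hXi : Polynomial.X ^ e i ∣ Q i ^ e i := X_pow_dvd_pow_of_eval_zero (by rw [hQeval]; exact hia) (e i)
    have hsplitQ : ∏ j, Q j ^ e j = Q j₀ ^ e j₀ * ∏ j ∈ Finset.univ.erase j₀, Q j ^ e j :=
      (Finset.mul_prod_erase Finset.univ (fun j => Q j ^ e j) (Finset.mem_univ j₀)).symm
    have hXi' : Polynomial.X ^ e i ∣ ∏ j ∈ Finset.univ.erase j₀, Q j ^ e j :=
      hXi.trans (Finset.dvd_prod_of_mem (fun j => Q j ^ e j) (Finset.mem_erase.mpr ⟨hi, Finset.mem_univ i⟩))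
    have hX3 : Polynomial.X ^ (e j₀ + e i) ∣ P := by
      rw [hPfac, hsplitQ, pow_add]
      exact Dvd.dvd.mul_left (mul_dvd_mul (X_pow_dvd_pow_of_eval_zero (by rw [hQeval]; exact hj₀a) _) hXi') _
    have h3 : 3 ≤ e j₀ + e i := by have := he i; omega
    exact hnot3 ((pow_dvd_pow Polynomial.X h3).trans hX3)
  · -- transversality
    intro hs
    have hder : (Polynomial.derivative (Q j₀)).eval 0 = 0 := by
      rw [hQ_def]
      show Polynomial.eval 0 (Polynomial.derivative (aeval line (h j₀))) = 0
      rw [derivative_aeval_line_eval_zero a v (h j₀)]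
      exact hs
    have hX2 : Polynomial.X ^ 2 ∣ Q j₀ :=
      X_sq_dvd_of_eval_zero_of_derivative_eval_zero (by rw [hQeval]; exact hj₀a) hder
    have hX4 : Polynomial.X ^ 4 ∣ P := by
      have h1 : Polynomial.X ^ 4 ∣ Q j₀ ^ e j₀ := by
        rw [he_eq, show (4 : ℕ) = 2 * 2 by norm_num, pow_mul]
        exact pow_dvd_pow_of_dvd hX2 2
      rw [hPfac]
      exact Dvd.dvd.mul_left (h1.trans (Finset.dvd_prod_of_mem (fun j => Q j ^ e j) (Finset.mem_univ j₀))) _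
    exact hnot3 ((pow_dvd_pow Polynomial.X (by norm_num : 3 ≤ 4)).trans hX4)

end Summit.HodgeConjecture.HodgeConjecture.Theorems.SignSymmetricPowersGenPairCentre

end
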